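import Mathlib
import Summits.Ventures.PercRepro2.SixTypedAll
import Summits.Ventures.PercRepro2.TypedResidualCore

/-!
# The rung `|F| = 6` is a theorem: `SixRung R` discharged (blind cell PercRepro2, p2 g6,
2026-08-25; sub-claim S1, the rung of night-3 g7's 45-file kernel chain `SixTypedAll`)

`SixRung R` is night-3 g7's target verbatim (INBOX 05:37:27Z; p2's named hypothesis of
TypedResidualSeven.lean): row 2′TRI at `z ≡ false` on every fully reduced typed graph with
`MarksDistinct` marks and exactly six typed edges, mixed types.  With the chain in the tree it is
the theorem **`sixRung_holds`** — the five-line discharge night-3 asked p2 for (INBOX 07:47:58Z):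
`typedCount_nonneg_of_reduced_card_six'` (SixTypedAll.lean) in the argument order of the Prop.

Own code; standard axioms.
-/

namespace Summit.Ventures.PercRepro2

open UnionCluster

namespace CovForm

namespace TypedRed

section Rung

variable (R : Type*) [Field R] [LinearOrder R] [IsStrictOrderedRing R]

/-- **The rung `|F| = 6`** (night-3 g7's kernel target): row 2′TRI at `z ≡ false` on every fully
reduced typed graph with `MarksDistinct` marks and six typed edges, mixed types. -/
def SixRung : Prop :=
  ∀ (V E : Type) [Fintype V] [DecidableEq V] [Fintype E] [DecidableEq E]
    (ends : E → Sym2 V) (o a₁ a₂ a₃ b : V) (F : Finset E) (τ : E → ℕ),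
    Reduced ends o a₁ a₂ a₃ b F → MarksDistinct o a₁ a₂ a₃ b → F.card = 6 →
    (∀ e ∈ F, τ e = 1 ∨ τ e = 2) →
      0 ≤ typedCount F (fun _ => false) τ
        (K3 ends o a₁ a₂ a₃ b : Config E → Config E → Config E → R)

/-- **The rung `|F| = 6` is a theorem** — night-3's `typedCount_nonneg_of_reduced_card_six'`
(SixTypedAll.lean: the 252 kernel groups of SixTypedShards1–20 through the sorted labelling, the
label guards and the generic bridge), in the argument order of `SixRung`. -/
theorem sixRung_holds : SixRung R :=
  fun _ _ _ _ _ _ ends o a₁ a₂ a₃ b F τ hred hm hF hτ =>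
    TwoTyped.typedCount_nonneg_of_reduced_card_six' ends o a₁ a₂ a₃ b hm F hF hred τ hτ

end Rung

end TypedRed

end CovForm

end Summit.Ventures.PercRepro2
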